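import Mathlib
import Summits.ValiantsHypothesis.ValiantsHypothesis.Theorems.BinomialElusiveBinomialCandidateAffinePeeling

/-!
# Crux `BinomialElusive.BinomialCandidate` (stmt-ValiantsHypothesis-7392), line `registered` —
# stub `stub_jetReduction`, part 1/4: filtered algebras and the key estimates

The registered stub `stub_jetReduction` (jet reduction at an immersive integral base point) is
proved in `…JetReduction.lean` by a finite Picard iteration.  Everything analytic in that proof
is one estimate, proved here once for an arbitrary commutative `R`-algebra `A` and a decreasing
multiplicative filtration, presented as a predicate `F : ℕ → A → Prop` (`F n x` = "`x` vanishes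
to order `n`") closed under `0, +, -`, decreasing in `n`, containing the constants at level `0`
and multiplicative (`F a x → F b y → F (a + b) (x * y)`); the six closure properties travel as
one conjunction `hF`:

* `filt_aeval` — a polynomial all of whose monomials have degree `≥ e`
  (`∀ d, d.degree < e → coeff d f = 0`), evaluated at elements of level `1`, is of level `e`;
* `filt_aeval_sub_aeval` — for such `f`, arguments of level `1` that agree to level `t + 1`
  give values that agree to level `t + e` (telescoping, `filt_prod_sub_prod`).

Two instances are used downstream and recorded here: the polynomial ring filtered by
"all monomials of degree `≥ n`" (`degGE_isFilt`; this tracks 2-jets) and `ℂ((t))` filtered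
`t`-adically (`laurentGE_isFilt`; this tracks orders of vanishing).  `jetReduction_estimates`
states the three estimates in the concrete form used by parts 2–4.  Mathlib only (plus the
wave-1 file `…AffinePeeling` for `algebraMap ℂ ℂ((t)) r = single 0 r`); no definitions.
-/

-- layout Summits/ValiantsHypothesis/ValiantsHypothesis forces the duplicated namespace component
set_option linter.dupNamespace false

namespace Summit.ValiantsHypothesis.ValiantsHypothesis.Theorems.BinomialCandidateStubs

open scoped BigOperators
open MvPolynomial

namespace JetReduction

/-! ## Calculus of a decreasing multiplicative filtration -/

section Filtration

variable {R A : Type*} [CommRing R] [CommRing A] [Algebra R A] {F : ℕ → A → Prop}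
  (hF : (∀ n, F n 0) ∧ (∀ n x y, F n x → F n y → F n (x + y)) ∧ (∀ n x, F n x → F n (-x)) ∧
    (∀ a b x, a ≤ b → F b x → F a x) ∧ (∀ r, F 0 (algebraMap R A r)) ∧
    (∀ a b x y, F a x → F b y → F (a + b) (x * y)))
include hF

/-- Levels are closed under finite sums. -/
theorem filt_sum {ι : Type*} (s : Finset ι) (u : ι → A) {n : ℕ} (hu : ∀ i ∈ s, F n (u i)) :
    F n (∑ i ∈ s, u i) :=
  Finset.sum_induction u (F n) (hF.2.1 n) (hF.1 n) hu

/-- Constants times level-`n` elements are of level `n`. -/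
theorem filt_algebraMap_mul {n : ℕ} (r : R) {x : A} (hx : F n x) : F n (algebraMap R A r * x) := by
  simpa using hF.2.2.2.2.2 0 n _ _ (hF.2.2.2.2.1 r) hx

/-- `1` is of level `0`. -/
theorem filt_one : F 0 1 := by simpa using hF.2.2.2.2.1 1

/-- Powers: level `1` to the `n`-th power is of level `n`. -/
theorem filt_pow {x : A} (hx : F 1 x) (n : ℕ) : F n (x ^ n) := by
  induction n with
  | zero => simpa using filt_one hF
  | succ n ih => rw [pow_succ]; exact hF.2.2.2.2.2 n 1 _ _ ih hx

/-- Products: `F (w i) (u i)` for all `i` gives `F (∑ w i) (∏ u i)`. -/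
theorem filt_prod {ι : Type*} (s : Finset ι) (u : ι → A) (w : ι → ℕ)
    (hu : ∀ i ∈ s, F (w i) (u i)) : F (∑ i ∈ s, w i) (∏ i ∈ s, u i) := by
  classical
  induction s using Finset.induction_on with
  | empty => simpa using filt_one hF
  | insert a s ha ih =>
    rw [Finset.prod_insert ha, Finset.sum_insert ha]
    exact hF.2.2.2.2.2 _ _ _ _ (hu a (by simp)) (ih fun i hi => hu i (Finset.mem_insert_of_mem hi))

/-- Telescoping: products of congruent factors are congruent, with the expected gain. -/
theorem filt_prod_sub_prod {ι : Type*} (s : Finset ι) (u v : ι → A) (w : ι → ℕ) (t : ℕ)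
    (hu : ∀ i ∈ s, F (w i) (u i)) (hv : ∀ i ∈ s, F (w i) (v i))
    (huv : ∀ i ∈ s, F (t + w i) (u i - v i)) :
    F (t + ∑ i ∈ s, w i) (∏ i ∈ s, u i - ∏ i ∈ s, v i) := by
  classical
  have hF' := hF
  obtain ⟨h0, hadd, -, hanti, -, hmul⟩ := hF'
  induction s using Finset.induction_on with
  | empty => simpa using h0 _
  | insert a s ha ih =>
    rw [Finset.prod_insert ha, Finset.prod_insert ha, Finset.sum_insert ha]
    have h1 : F (t + w a + ∑ i ∈ s, w i) ((u a - v a) * ∏ i ∈ s, u i) :=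
      hmul _ _ _ _ (huv a (by simp)) (filt_prod hF s u w fun i hi => hu i (by simp [hi]))
    have h2 : F (w a + (t + ∑ i ∈ s, w i)) (v a * (∏ i ∈ s, u i - ∏ i ∈ s, v i)) :=
      hmul _ _ _ _ (hv a (by simp)) (ih (fun i hi => hu i (by simp [hi]))
        (fun i hi => hv i (by simp [hi])) (fun i hi => huv i (by simp [hi])))
    have : (u a * ∏ i ∈ s, u i - v a * ∏ i ∈ s, v i) =
        (u a - v a) * ∏ i ∈ s, u i + v a * (∏ i ∈ s, u i - ∏ i ∈ s, v i) := by ring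
    rw [this]
    exact hadd _ _ _ (hanti _ _ _ (by omega) h1) (hanti _ _ _ (by omega) h2)

/-- `x ≡ y` to level `t + 1` with `x, y` of level `1` gives `x ^ n ≡ y ^ n` to level `t + n`. -/
theorem filt_pow_sub_pow {x y : A} (t : ℕ) (hx : F 1 x) (hy : F 1 y) (hxy : F (t + 1) (x - y))
    (n : ℕ) : F (t + n) (x ^ n - y ^ n) := by
  simpa using filt_prod_sub_prod hF (Finset.range n) (fun _ => x) (fun _ => y) (fun _ => 1) t
    (fun _ _ => hx) (fun _ _ => hy) (fun _ _ => hxy)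

variable {σ : Type*}

/-- **Basic estimate.** A polynomial with all monomials of degree `≥ e`, evaluated at elements
of level `1`, is of level `e`. -/
theorem filt_aeval {e : ℕ} {f : MvPolynomial σ R} (hf : ∀ d : σ →₀ ℕ, d.degree < e → coeff d f = 0)
    {x : σ → A} (hx : ∀ j, F 1 (x j)) : F e (aeval x f) := by
  rw [aeval_def, eval₂_eq]
  refine filt_sum hF _ _ fun d hd => ?_
  have hdeg : e ≤ d.degree := by
    by_contra h
    exact (mem_support_iff.mp hd) (hf d (by omega))
  have hprod := filt_prod hF d.support (fun i => x i ^ d i) (fun i => d i)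
    (fun i _ => filt_pow hF (hx i) (d i))
  rw [← Finsupp.degree_apply] at hprod
  exact hF.2.2.2.1 _ _ _ hdeg (filt_algebraMap_mul hF _ hprod)

/-- **Key estimate.** For a polynomial with all monomials of degree `≥ e`, arguments of level
`1` congruent to level `t + 1` give values congruent to level `t + e`. -/
theorem filt_aeval_sub_aeval {e : ℕ} {f : MvPolynomial σ R}
    (hf : ∀ d : σ →₀ ℕ, d.degree < e → coeff d f = 0) {x y : σ → A}
    (hx : ∀ j, F 1 (x j)) (hy : ∀ j, F 1 (y j)) (t : ℕ) (hxy : ∀ j, F (t + 1) (x j - y j)) :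
    F (t + e) (aeval x f - aeval y f) := by
  rw [aeval_def, aeval_def, eval₂_eq, eval₂_eq, ← Finset.sum_sub_distrib]
  refine filt_sum hF _ _ fun d hd => ?_
  rw [← mul_sub]
  have hdeg : e ≤ d.degree := by
    by_contra h
    exact (mem_support_iff.mp hd) (hf d (by omega))
  have hprod := filt_prod_sub_prod hF d.support (fun i => x i ^ d i) (fun i => y i ^ d i)
    (fun i => d i) t (fun i _ => filt_pow hF (hx i) (d i)) (fun i _ => filt_pow hF (hy i) (d i))
    (fun i _ => filt_pow_sub_pow hF t (hx i) (hy i) (hxy i) (d i))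
  rw [← Finsupp.degree_apply] at hprod
  exact hF.2.2.2.1 _ _ _ (by omega) (filt_algebraMap_mul hF _ hprod)

end Filtration

/-! ## Instance 1: polynomials, filtered by "all monomials of degree `≥ n`" -/

section Poly

variable (σ R : Type*) [CommRing R]

/-- The predicate `∀ d, d.degree < n → coeff d f = 0` ("all monomials of `f` have degree `≥ n`",
membership in the `n`-th power of the irrelevant ideal) is a decreasing multiplicative
filtration of `MvPolynomial σ R`. -/
theorem degGE_isFilt :
    (∀ n, ∀ d : σ →₀ ℕ, d.degree < n → coeff d (0 : MvPolynomial σ R) = 0) ∧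
    (∀ n (x y : MvPolynomial σ R), (∀ d : σ →₀ ℕ, d.degree < n → coeff d x = 0) →
      (∀ d : σ →₀ ℕ, d.degree < n → coeff d y = 0) →
      ∀ d : σ →₀ ℕ, d.degree < n → coeff d (x + y) = 0) ∧
    (∀ n (x : MvPolynomial σ R), (∀ d : σ →₀ ℕ, d.degree < n → coeff d x = 0) →
      ∀ d : σ →₀ ℕ, d.degree < n → coeff d (-x) = 0) ∧
    (∀ a b (x : MvPolynomial σ R), a ≤ b → (∀ d : σ →₀ ℕ, d.degree < b → coeff d x = 0) →
      ∀ d : σ →₀ ℕ, d.degree < a → coeff d x = 0) ∧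
    (∀ r : R, ∀ d : σ →₀ ℕ, d.degree < 0 → coeff d (algebraMap R (MvPolynomial σ R) r) = 0) ∧
    (∀ a b (x y : MvPolynomial σ R), (∀ d : σ →₀ ℕ, d.degree < a → coeff d x = 0) →
      (∀ d : σ →₀ ℕ, d.degree < b → coeff d y = 0) →
      ∀ d : σ →₀ ℕ, d.degree < a + b → coeff d (x * y) = 0) := by
  classical
  refine ⟨fun _ _ _ => coeff_zero _, fun n x y hx hy d hd => by simp [hx d hd, hy d hd],
    fun n x hx d hd => by simp [hx d hd], fun a b x hab hx d hd => hx d (lt_of_lt_of_le hd hab),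
    fun r d hd => absurd hd (Nat.not_lt_zero _), fun a b x y hx hy d hd => ?_⟩
  rw [coeff_mul]
  refine Finset.sum_eq_zero fun z hz => ?_
  rw [Finset.HasAntidiagonal.mem_antidiagonal] at hz
  have hdeg : z.1.degree + z.2.degree = d.degree := by rw [← map_add, hz]
  by_cases h1 : z.1.degree < a
  · rw [hx _ h1, zero_mul]
  · rw [hy _ (by omega), mul_zero]

variable {σ R} {τ : Type*}

/-- Substituting polynomials without constant term into a polynomial with all monomials of
degree `≥ e` gives a polynomial with all monomials of degree `≥ e`. -/
theorem aeval_degGE {e : ℕ} {f : MvPolynomial σ R} (hf : ∀ d : σ →₀ ℕ, d.degree < e → coeff d f = 0)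
    {g : σ → MvPolynomial τ R} (hg : ∀ j, ∀ d : τ →₀ ℕ, d.degree < 1 → coeff d (g j) = 0) :
    ∀ d : τ →₀ ℕ, d.degree < e → coeff d (aeval g f) = 0 :=
  filt_aeval (F := fun n (h : MvPolynomial τ R) => ∀ d : τ →₀ ℕ, d.degree < n → coeff d h = 0)
    (degGE_isFilt τ R) hf hg

/-- Congruent substitutions (to degree `≥ t + 1`) into a polynomial with all monomials of degree
`≥ e` agree to degree `≥ t + e`. -/
theorem aeval_sub_aeval_degGE {e t : ℕ} {f : MvPolynomial σ R}
    (hf : ∀ d : σ →₀ ℕ, d.degree < e → coeff d f = 0) {g g' : σ → MvPolynomial τ R}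
    (hg : ∀ j, ∀ d : τ →₀ ℕ, d.degree < 1 → coeff d (g j) = 0)
    (hg' : ∀ j, ∀ d : τ →₀ ℕ, d.degree < 1 → coeff d (g' j) = 0)
    (hgg' : ∀ j, ∀ d : τ →₀ ℕ, d.degree < t + 1 → coeff d (g j - g' j) = 0) :
    ∀ d : τ →₀ ℕ, d.degree < t + e → coeff d (aeval g f - aeval g' f) = 0 :=
  filt_aeval_sub_aeval
    (F := fun n (h : MvPolynomial τ R) => ∀ d : τ →₀ ℕ, d.degree < n → coeff d h = 0)
    (degGE_isFilt τ R) hf hg hg' t hgg'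

end Poly

/-! ## Instance 2: `ℂ((t))`, filtered `t`-adically -/

section Laurent

/-- The predicate `∀ g < n, x.coeff g = 0` ("`x` vanishes to order `n`") is a decreasing
multiplicative filtration of `ℂ((t))` (orders of vanishing add under multiplication). -/
theorem laurentGE_isFilt :
    (∀ n : ℕ, ∀ g : ℤ, g < n → (0 : LaurentSeries ℂ).coeff g = 0) ∧
    (∀ (n : ℕ) (x y : LaurentSeries ℂ), (∀ g : ℤ, g < n → x.coeff g = 0) →
      (∀ g : ℤ, g < n → y.coeff g = 0) → ∀ g : ℤ, g < n → (x + y).coeff g = 0) ∧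
    (∀ (n : ℕ) (x : LaurentSeries ℂ), (∀ g : ℤ, g < n → x.coeff g = 0) →
      ∀ g : ℤ, g < n → (-x).coeff g = 0) ∧
    (∀ (a b : ℕ) (x : LaurentSeries ℂ), a ≤ b → (∀ g : ℤ, g < b → x.coeff g = 0) →
      ∀ g : ℤ, g < a → x.coeff g = 0) ∧
    (∀ r : ℂ, ∀ g : ℤ, g < (0 : ℕ) → (algebraMap ℂ (LaurentSeries ℂ) r).coeff g = 0) ∧
    (∀ (a b : ℕ) (x y : LaurentSeries ℂ), (∀ g : ℤ, g < a → x.coeff g = 0) →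
      (∀ g : ℤ, g < b → y.coeff g = 0) → ∀ g : ℤ, g < (a + b : ℕ) → (x * y).coeff g = 0) := by
  refine ⟨fun _ _ _ => by simp, fun n x y hx hy g hg => by simp [hx g hg, hy g hg],
    fun n x hx g hg => by simp [hx g hg], fun a b x hab hx g hg => hx g (by omega),
    fun r g hg => ?_, fun a b x y hx hy g hg => ?_⟩
  · rw [AffinePeeling.algebraMap_laurentSeries_apply, HahnSeries.coeff_single_of_ne (by omega)]
  · rw [HahnSeries.coeff_mul]
    refine Finset.sum_eq_zero fun ij hij => ?_
    rw [Finset.mem_antidiagonal] at hij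
    obtain ⟨h1, h2, h3⟩ := hij
    by_cases hi : ij.1 < (a : ℤ)
    · exact absurd (hx _ hi) ((HahnSeries.mem_support _ _).mp h1)
    · have hj : ij.2 < (b : ℤ) := by push_cast at hg; omega
      exact absurd (hy _ hj) ((HahnSeries.mem_support _ _).mp h2)

end Laurent

end JetReduction

/-- **Jet reduction, part 1 — the estimates** (helper of the stub `stub_jetReduction`), in the
concrete form used downstream: (1) the `t`-adic key estimate in `ℂ((t))`: for `f` with all
monomials of degree `≥ e` and arguments of positive order agreeing below `t + 1`, the values
agree below `t + e`; (2) the same for polynomial substitutions and degrees; (3) substituting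
polynomials without constant term preserves "all monomials of degree `≥ e`". -/
theorem jetReduction_estimates :
    (∀ (k e t : ℕ) (f : MvPolynomial (Fin k) ℂ) (x y : Fin k → LaurentSeries ℂ),
      (∀ d : Fin k →₀ ℕ, d.degree < e → MvPolynomial.coeff d f = 0) →
      (∀ j, ∀ g : ℤ, g < (1 : ℕ) → (x j).coeff g = 0) →
      (∀ j, ∀ g : ℤ, g < (1 : ℕ) → (y j).coeff g = 0) →
      (∀ j, ∀ g : ℤ, g < (t + 1 : ℕ) → (x j - y j).coeff g = 0) →
      ∀ g : ℤ, g < (t + e : ℕ) → (MvPolynomial.aeval x f - MvPolynomial.aeval y f).coeff g = 0) ∧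
    (∀ (k l e t : ℕ) (f : MvPolynomial (Fin k) ℂ) (g g' : Fin k → MvPolynomial (Fin l) ℂ),
      (∀ d : Fin k →₀ ℕ, d.degree < e → MvPolynomial.coeff d f = 0) →
      (∀ j, ∀ d : Fin l →₀ ℕ, d.degree < 1 → MvPolynomial.coeff d (g j) = 0) →
      (∀ j, ∀ d : Fin l →₀ ℕ, d.degree < 1 → MvPolynomial.coeff d (g' j) = 0) →
      (∀ j, ∀ d : Fin l →₀ ℕ, d.degree < t + 1 → MvPolynomial.coeff d (g j - g' j) = 0) →
      ∀ d : Fin l →₀ ℕ, d.degree < t + e →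
        MvPolynomial.coeff d (MvPolynomial.aeval g f - MvPolynomial.aeval g' f) = 0) ∧
    (∀ (k l e : ℕ) (f : MvPolynomial (Fin k) ℂ) (g : Fin k → MvPolynomial (Fin l) ℂ),
      (∀ d : Fin k →₀ ℕ, d.degree < e → MvPolynomial.coeff d f = 0) →
      (∀ j, ∀ d : Fin l →₀ ℕ, d.degree < 1 → MvPolynomial.coeff d (g j) = 0) →
      ∀ d : Fin l →₀ ℕ, d.degree < e → MvPolynomial.coeff d (MvPolynomial.aeval g f) = 0) :=
  ⟨fun _ _ t _ _ _ hf hx hy hxy =>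
      JetReduction.filt_aeval_sub_aeval
        (F := fun n (z : LaurentSeries ℂ) => ∀ g : ℤ, g < n → z.coeff g = 0)
        JetReduction.laurentGE_isFilt hf hx hy t hxy,
    fun _ _ _ _ _ _ _ hf hg hg' hgg' => JetReduction.aeval_sub_aeval_degGE hf hg hg' hgg',
    fun _ _ _ _ _ hf hg => JetReduction.aeval_degGE hf hg⟩

end Summit.ValiantsHypothesis.ValiantsHypothesis.Theorems.BinomialCandidateStubs
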